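import Summits.MatrixMultiplication.OmegaCensus.PhaseArcClassMain
import Summits.MatrixMultiplication.OmegaCensus.PhaseArcClassTable1
import Summits.MatrixMultiplication.OmegaCensus.PhaseArcClassTable2
import Summits.MatrixMultiplication.OmegaCensus.PhaseArcThue

/-!
# ω-census, family (b3): conjecture C9 — the UNIFORM THEOREM: `C_p ⋊ C₃` is not box-useful for every prime `p ≡ 1 (mod 3)`, `p ≥ 1201`

HONEST FRAMING (pub-omega census; verbatim): lottery ticket; floor = certified bounds/negative ranges.
Census BOOKKEEPING (conjecture C9 of the cell; pub-omega stpp-1 gen 21).  Assembly of Layers 1–5 of the uniform phase-arc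
construction for the Frobenius groups `ℤ/p ⋊_u ℤ/3` (design note HOME/pub-omega-stpp-1-g20/UNIFORM-FROBENIUS-DESIGN.md):
* `table` : the 48-class table of `PhaseArcClassTable1/2` as a function of the residue pair `(a₀, a₁) mod 8`, and **`table_ok`**:
  every primitive pair passes the class check `ClassOK` (ONE `decide`);
* **`MetaCyc.not_boxUseful_frob3_ge`**: for a prime `p ≥ 1201` and `u` with `u² + u + 1 = 0`, `¬ BoxUseful (MetaCyc p 3 u)`.
  Proof: Thue (`thue_primitive`) gives `0 < e₀ ≤ √p`, `|e₁| ≤ √p`, `e₁ ≡ u e₀`, not both even; `α := e₀/8`, `e₂ := −e₀ − e₁`,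
  so `8 u^k α ≡ e_k` and `8·(u^k α).val = a_k p + e_k`; `Σ a_k ≡ 0 (mod 8)` and `(a₀, a₁) ≢ (even, even)` (as `p` is odd), so the
  residues `γ = (a_k mod 8)` are a table entry's argument and `table_ok` applies; with `ε = |e₀| + |e₁|` (`ε² ≤ 4p`) the size
  conditions `120ε ≤ 8p − 1200`, `145ε ≤ 13p − 1275`, `6ε < p` hold from `p ≥ 1201`; conclude by `not_boxUseful_of_classOK`.
The primes `7 ≤ p < 1201` are covered by explicit patterns / numeric certificates (`BoxBadFrobeniusPatterns*`, `…PhaseCerts1–15`);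
the all-`p` statement is assembled in `FrobeniusAll.lean`.  Nothing here is progress on `ω`.
-/

namespace Summit.MatrixMultiplication.OmegaCensus

open Finset

namespace PhaseArcs

/-- A residue pair `(a₀, a₁) mod 8` is *primitive* when not both residues are even. [folklore] -/
def Prim (γ₀ γ₁ : ZMod 8) : Prop := ¬ (2 ∣ γ₀.val ∧ 2 ∣ γ₁.val)

/-- Primitivity is decidable. [folklore] -/
instance (γ₀ γ₁ : ZMod 8) : Decidable (Prim γ₀ γ₁) := by
  unfold Prim; infer_instance

/-- The class table as a function of the residue pair (non-primitive entries are placeholders). [folklore] -/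
def table (γ₀ γ₁ : ZMod 8) : ClassData :=
  (![
    ![cd_0_1, cd_0_1, cd_0_1, cd_0_3, cd_0_1, cd_0_5, cd_0_1, cd_0_7],
    ![cd_1_0, cd_1_1, cd_1_2, cd_1_3, cd_1_4, cd_1_5, cd_1_6, cd_1_7],
    ![cd_0_1, cd_2_1, cd_0_1, cd_2_3, cd_0_1, cd_2_5, cd_0_1, cd_2_7],
    ![cd_3_0, cd_3_1, cd_3_2, cd_3_3, cd_3_4, cd_3_5, cd_3_6, cd_3_7],
    ![cd_0_1, cd_4_1, cd_0_1, cd_4_3, cd_0_1, cd_4_5, cd_0_1, cd_4_7],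
    ![cd_5_0, cd_5_1, cd_5_2, cd_5_3, cd_5_4, cd_5_5, cd_5_6, cd_5_7],
    ![cd_0_1, cd_6_1, cd_0_1, cd_6_3, cd_0_1, cd_6_5, cd_0_1, cd_6_7],
    ![cd_7_0, cd_7_1, cd_7_2, cd_7_3, cd_7_4, cd_7_5, cd_7_6, cd_7_7]] : Fin 8 → Fin 8 → ClassData) γ₀ γ₁

/-- **Every primitive class passes the class check.** [folklore] -/
theorem table_ok : ∀ γ₀ γ₁ : ZMod 8, Prim γ₀ γ₁ → (table γ₀ γ₁).ClassOK ![γ₀, γ₁, -γ₀ - γ₁] := by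
  decide +kernel

/-- `120 ε ≤ 8p − 1200` for `p ≥ 1201`, `ε² ≤ 4p`. [folklore] -/
theorem env16 {p ε : ℤ} (hp : 1201 ≤ p) (hε2 : ε ^ 2 ≤ 4 * p) : 120 * ε ≤ 8 * p - 1200 := by
  by_contra hc
  push Not at hc
  have hR : (0 : ℤ) ≤ 8 * p - 1200 := by omega
  have h1 := mul_self_lt_mul_self hR hc
  have h3 : 1201 * p ≤ p * p := by nlinarith
  nlinarith

/-- `145 ε ≤ 13p − 1275` for `p ≥ 1201`, `ε² ≤ 4p`. [folklore] -/
theorem env17 {p ε : ℤ} (hp : 1201 ≤ p) (hε2 : ε ^ 2 ≤ 4 * p) : 145 * ε ≤ 13 * p - 1275 := by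
  by_contra hc
  push Not at hc
  have hR : (0 : ℤ) ≤ 13 * p - 1275 := by omega
  have h1 := mul_self_lt_mul_self hR hc
  have h3 : 1201 * p ≤ p * p := by nlinarith
  nlinarith

/-- `6 ε < p` for `p ≥ 1201`, `ε² ≤ 4p`. [folklore] -/
theorem envE {p ε : ℤ} (hp : 1201 ≤ p) (hε2 : ε ^ 2 ≤ 4 * p) : 6 * ε < p := by
  by_contra hc
  push Not at hc
  have h1 := mul_self_le_mul_self (by omega : (0 : ℤ) ≤ p) hc
  nlinarith

end PhaseArcs

namespace MetaCyc

open PhaseArcs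

/-- **UNIFORM THEOREM.** For every prime `p ≥ 1201` and every `u ∈ ZMod p` with `u² + u + 1 = 0` (so `p ≡ 1 (mod 3)` and
`u` is a primitive cube root of unity), the Frobenius group `C_p ⋊_u C₃ = MetaCyc p 3 u` is not box-useful: it has a `3 × 3` box
with an independent cell set of at least `(9/5)·3p` cells. [folklore] -/
theorem not_boxUseful_frob3_ge {p : ℕ} [Fact p.Prime] (hp : 1201 ≤ p) (u : ZMod p) [Fact (u ^ 3 = 1)]
    (hu : u ^ 2 + u + 1 = 0) : ¬ BoxUseful (MetaCyc p 3 u) := by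
  have hprime : p.Prime := Fact.out
  haveI : NeZero p := ⟨hprime.ne_zero⟩
  have hodd : Odd p := hprime.odd_of_ne_two (by omega)
  -- Thue: a primitive short vector `(x, y)`, `y ≡ u x`
  obtain ⟨x, y, hx0, hxx, hyy, hyx, hprim⟩ := thue_primitive p (by omega) hodd u
  set e : ZMod 3 → ℤ := (![x, y, -x - y] : Fin 3 → ℤ) with he
  have he0 : e 0 = x := rfl
  have he1 : e 1 = y := rfl
  have he2 : e 2 = -x - y := rfl
  -- `α = x / 8`
  have h8 : (8 : ZMod p) ≠ 0 := by
    intro h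
    have h' : ((8 : ℕ) : ZMod p) = 0 := by exact_mod_cast h
    rw [ZMod.natCast_eq_zero_iff] at h'
    have := Nat.le_of_dvd (by norm_num) h'
    omega
  set α : ZMod p := (x : ZMod p) * (8 : ZMod p)⁻¹ with hαdef
  have h8α : (8 : ZMod p) * α = x := by
    rw [hαdef, mul_comm, mul_assoc, inv_mul_cancel₀ h8, mul_one]
  have hα : α ≠ 0 := by
    intro h
    rw [h, mul_zero] at h8α
    have hx : ((x : ℤ) : ZMod p) = 0 := h8α.symm
    rw [ZMod.intCast_zmod_eq_zero_iff_dvd] at hx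
    have := Int.le_of_dvd hx0 hx
    nlinarith
  -- `8 u^k α ≡ e_k`
  have hu3 : u ^ 3 = 1 := Fact.out
  have hk3 : ∀ k : ZMod 3, k = 0 ∨ k = 1 ∨ k = 2 := by decide
  have hek : ∀ k : ZMod 3, (8 : ZMod p) * (MetaCyc.act u k * α) = (e k : ZMod p) := by
    intro k
    rcases hk3 k with rfl | rfl | rfl
    · rw [he0, MetaCyc.act_zero, one_mul, h8α]
    · have h1 : MetaCyc.act u (1 : ZMod 3) = u := by rw [MetaCyc.act, ZMod.val_one, pow_one]
      rw [he1, h1]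
      linear_combination u * h8α - hyx
    · have hv : (2 : ZMod 3).val = 2 := rfl
      have h2 : MetaCyc.act u (2 : ZMod 3) = u ^ 2 := by rw [MetaCyc.act, hv]
      rw [he2, h2]
      push_cast
      linear_combination u ^ 2 * h8α + (x : ZMod p) * hu + hyx
  -- phases `a_k`
  have hdvd : ∀ k, (p : ℤ) ∣ 8 * ((MetaCyc.act u k * α).val : ℤ) - e k := by
    intro k
    rw [← ZMod.intCast_zmod_eq_zero_iff_dvd]
    push_cast
    rw [ZMod.natCast_val, ZMod.cast_id', id_eq, hek k, sub_self]
  set a : ZMod 3 → ℤ := fun k => (8 * ((MetaCyc.act u k * α).val : ℤ) - e k) / p with hadef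
  have ha : ∀ k, 8 * ((MetaCyc.act u k * α).val : ℤ) = a k * p + e k := by
    intro k
    simp only [hadef]
    rw [Int.ediv_mul_cancel (hdvd k)]
    ring
  have hsum3 : e 0 + e 1 + e 2 = 0 := by rw [he0, he1, he2]; ring
  have hsum : ∑ k, e k = 0 := (Fin.sum_univ_three e).trans hsum3
  -- `ε = |x| + |y|`
  set ε : ℤ := |x| + |y| with hεdef
  have hε0 : 0 ≤ ε := by positivity
  have hε : ∀ k, |e k| ≤ ε := by
    intro k
    rcases hk3 k with rfl | rfl | rfl
    · rw [he0, hεdef]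
      linarith [abs_nonneg y]
    · rw [he1, hεdef]
      linarith [abs_nonneg x]
    · rw [he2, hεdef]
      calc |-x - y| = |x + y| := by rw [← abs_neg]; ring_nf
        _ ≤ |x| + |y| := abs_add_le x y
  have hε2 : ε ^ 2 ≤ 4 * p := by
    rw [hεdef]
    nlinarith [sq_abs x, sq_abs y, sq_nonneg (|x| - |y|), abs_nonneg x, abs_nonneg y]
  -- residues mod 8: `Σ a ≡ 0`, `(a₀, a₁)` primitive
  have hpodd : Odd (p : ℤ) := by exact_mod_cast hodd
  have hS8 : ((a 0 + a 1 + a 2 : ℤ) : ZMod 8) = 0 := by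
    rw [ZMod.intCast_zmod_eq_zero_iff_dvd]
    apply dvd8_of_odd_mul hpodd
    refine ⟨((MetaCyc.act u (0 : ZMod 3) * α).val : ℤ) + (MetaCyc.act u (1 : ZMod 3) * α).val
      + (MetaCyc.act u (2 : ZMod 3) * α).val, ?_⟩
    linear_combination (-1 : ℤ) * ha 0 - ha 1 - ha 2 - hsum3
  set γ₀ : ZMod 8 := (a 0 : ZMod 8) with hγ₀
  set γ₁ : ZMod 8 := (a 1 : ZMod 8) with hγ₁
  have hγ2 : ((a 2 : ℤ) : ZMod 8) = -γ₀ - γ₁ := by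
    push_cast at hS8
    linear_combination hS8
  have hfun : (fun k => (a k : ZMod 8)) = ![γ₀, γ₁, -γ₀ - γ₁] := by
    funext k
    rcases hk3 k with rfl | rfl | rfl
    · rfl
    · rfl
    · rw [hγ2]
      rfl
  have hprim' : Prim γ₀ γ₁ := by
    rintro ⟨⟨c0, hc0⟩, ⟨c1, hc1⟩⟩
    apply hprim
    have g0 : ((γ₀.val : ℕ) : ℤ) = a 0 % 8 := ZMod.val_intCast (a 0)
    have g1 : ((γ₁.val : ℕ) : ℤ) = a 1 % 8 := ZMod.val_intCast (a 1)
    rw [hc0] at g0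
    rw [hc1] at g1
    push_cast at g0 g1
    have q0 := Int.emod_add_mul_ediv (a 0) 8
    have q1 := Int.emod_add_mul_ediv (a 1) 8
    have ha0 := ha 0
    have ha1 := ha 1
    rw [he0] at ha0
    rw [he1] at ha1
    constructor
    · refine ⟨4 * ((MetaCyc.act u (0 : ZMod 3) * α).val : ℤ) - ((c0 : ℤ) + 4 * (a 0 / 8)) * p, ?_⟩
      linear_combination (-1 : ℤ) * ha0 + (p : ℤ) * q0 + (p : ℤ) * g0
    · refine ⟨4 * ((MetaCyc.act u (1 : ZMod 3) * α).val : ℤ) - ((c1 : ℤ) + 4 * (a 1 / 8)) * p, ?_⟩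
      linear_combination (-1 : ℤ) * ha1 + (p : ℤ) * q1 + (p : ℤ) * g1
  -- the class check and the size conditions
  have hok := table_ok γ₀ γ₁ hprim'
  rw [← hfun] at hok
  have hp' : (1201 : ℤ) ≤ p := by exact_mod_cast hp
  have h16 := env16 hp' hε2
  have h17 := env17 hp' hε2
  have hE := envE hp' hε2
  exact not_boxUseful_of_classOK u hu (by omega) α hα a e ha hsum ε hε (table γ₀ γ₁) hok ⟨h16, h17, hE⟩

end MetaCyc

end Summit.MatrixMultiplication.OmegaCensus
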